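import Summits.QuantumFields.YangMills.Theorems.UnitScaleTiltProp7OneFormGarding
import Summits.QuantumFields.YangMills.Theorems.UnitScaleTiltProp7MassivePropagatorAgmonLetters
import HarnessLib

/-!
# Route `UnitScaleTilt`, crux K1 «MinimiserStabilityRegPr» (stmt-QuantumFields-19200), EX face S45 — (L3′b), ONE-FORM STOREY, (P-1FA) FILE A3:
# **THE WEIGHTED-`L²` (AGMON ∕ (3.46)-CLASS) BOUND FOR THE MEMBER's ONE-FORM OPERATOR `Δ_a = Δx + D R_S D* + Q*aQ`, ASSEMBLED** — A1's ✓`agmon_bound_of_garding` INSTANTIATED at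
# `E := BondL2K`, the Kato gradient `D : A ↦ (D_{U₀}A_μ)_μ` into `PiLp 2 (Fin 3 → BondL2K)` (∃-packaged), `V := Δ_a − D†D`, and the site-weight multipliers `M = w∘src·`, `Mi = w⁻¹∘src·`
# (componentwise on the target), with the gradient conjugation defects `K₁`, `K₁′` CONSTRUCTED and BOUNDED (`δ₁² = 3η⁻²ρ²`, px5 g11 ✓`normSq_gradDefect_le` per component):
# for `Δ_a u = f` and every positive site weight with bond ratios `≤ ρ` both ways,
# `((1−ε)γ − εC_V − 3η⁻²ρ²(1+1∕ε) − θ_V)·‖w·u‖ ≤ ‖w·f‖` modulo the three displayed FORM letters (γ) coercivity, (C_V) the remainder's lower bound, (θ_V) the remainder's conjugation defect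

Cell `ym3-torus` (HUMAN RULING D-0037; rung R3 = SU(2) YM₃ on T³ — NOT d = 4, NOT infinite volume, NOT a mass gap, NOT Clay).  Chair seat ★`ym-ust-19200-p1` g26, own pen (P-1FA) A3
(CHAIR WORD №6 [p1-g26] SPLIT: A1 ✓p764720 chair, A2 `…OneFormAgmonLetters` px21 g14 = the supplier of (θ_V), A3 this file).  THEOREMS ONLY (0 `def`, 0 `sorry`, default heartbeats);
`--supports stmt-QuantumFields-19200 --as helper`; count-neutral.

WHY.  The pointwise DECAY of the one-form Green's functions behind `h133`∕`h137k•`∕`hCk` and the row sums of `norm_G`∕`norm_H` is (V4's pattern) the Kato bootstrap O2 run with an Agmon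
weight, fed by a WEIGHTED `L²` bound — [Balaban1985BackgroundPropagators] (3.46)-class.  A1 proved the engine for `T = D†D + V`; this file builds the member's `D`, the weights and the
gradient defects, and leaves exactly the three FORM letters that are genuinely analytic: (γ) = the LOD target `hT` shape (S45), (C_V) ⟸ A1 ✓`katoEnergy_le` + the slot's form bound,
(θ_V) ⟸ A2 (px21 g14: `D*`, `[Q_k, w]`, `[P, w]`, local and slot conjugation defects, summed).
THE OBJECTS (all inside the proof; no definition).  `E := BondL2K ℂ 3 (periodsT3 F K) c₀ W₂`; `G := PiLp 2 (Fin (F.P K).d → E)`; `D v := (μ ↦ D_{U₀}(toL2S (toL2⁻¹v)_μ))` (`exists_katoGradient`);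
`M(toL2 X) := toL2 (b ↦ w(b.src)•X b)`, `Mi` the same with `w⁻¹`; `M′`, `M′i` componentwise `M`, `Mi` on `G`; `K₁ := M′i∘D∘M − D`, `K₁′ := M′∘D∘Mi − D`.
WHAT IS PROVED (ns `Summit.QuantumFields.YangMills.Theorems.Prop7OneFormAgmon`).
* §1 `exists_smulBond` (the multiplier `M_ω` on `E` with `M_ω(toL2 X) = toL2(ω•X)`, ∃-packaged), `norm_sq_toL2_eq_sum_formComp` (`‖toL2 X‖² = Σ_μ‖toL2S X_μ‖²`),
  ★`exists_katoGradient` (`D` with `(D v) μ = D_{U₀}(toL2S (toL2⁻¹v)_μ)`, `‖Dv‖² = Σ_μ‖…‖²`, `⟪Da, Db⟫ = Σ_μ⟪…,…⟫`).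
* §2 ★★★ `agmon_oneForm_of_letters` — THE BOUND above, for EVERY background `U₀`, slot `Δx`, coupling `a`, weight `w > 0` with `|w(b₊)∕w(b₋) − 1| ≤ ρ` and `|w(b₋)∕w(b₊) − 1| ≤ ρ`, every
  `0 < ε ≤ 1`, modulo (γ)(C_V)(θ_V) — CONDITIONAL.  With `w = e^{φ}`, `|φ(b₊) − φ(b₋)| ≤ μη`: `ρ = e^{μη} − 1`, `3η⁻²ρ² ≤ 3μ²e^{2}` for `μη ≤ 1` — K-FREE.
HONEST SCOPE.  Assembly∕bookkeeping over A1 and px5 g11's weight letters; (γ)(C_V)(θ_V) displayed; nothing of the ten EX rows, `hT`, (3.46)∕Thm 3.12 for print's operators, EX or the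
crux is proved here.

References: T. Bałaban, CMP **99** (1985) 389–434 [Balaban1985BackgroundPropagators] ((3.3) p.391, (3.11) p.392, (3.26) p.395, Thm 3.1 (3.46) p.398, Thm 3.12 p.422);
CMP **102** (1985) 277–309 [Balaban1985Variational] ((134)–(136) p.298); S. Agmon, *Lectures on exponential decay* (Princeton 1982) Ch. 1 [folklore].
-/

set_option autoImplicit false

noncomputable section

open scoped Matrix.Norms.L2Operator BigOperators InnerProductSpace ComplexConjugate

namespace Summit.QuantumFields.YangMills.Theorems.Prop7OneFormAgmon

open Literature.MathematicalPhysics.QuantumFieldTheory.Balaban1983to89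
open Literature.MathematicalPhysics.QuantumFieldTheory.Balaban1983to89.T3ContinuumYM3Torus
open T3SectALandauChart (formComp bgUnits eta eta_pos)
open B9Eq39Adjoint (R)
open B11Eq103H1Complex (SiteL2K BondL2K)
open Summit.QuantumFields.YangMills.Theorems.Prop7SectET3Transport (periodsT3)
open Summit.QuantumFields.YangMills.Theorems.Prop7SectET3HilbertLetters (W₂ toL2 toL2S DL2 inner_toL2)
open Summit.QuantumFields.YangMills.Theorems.Prop7SectET3CurvedPropagators (laplaceA)
open Summit.QuantumFields.YangMills.Theorems.Prop7MassivePropagatorAgmonLetters (inner_toL2_smul_left inner_toL2_smul_smul_inv DL2_smul_eq_smul_add_defect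
  normSq_gradDefect_le)
open Summit.QuantumFields.YangMills.Theorems.Prop7OneFormGarding (agmon_bound_of_garding sum_inner_toL2S_formComp)

variable {F : T3Family} {n K : ℕ} {c₀ : ℝ} [Fact (0 < c₀)]

/-! ## §1 The multipliers, the component sum of the norm, the Kato gradient -/

omit [Fact (0 < c₀)] in
/-- **THE BOND MULTIPLIER `M_ω` ON THE WEIGHTED `L²` SPACE, ∃-PACKAGED**: a linear map with `M_ω(toL2 X) = toL2(b ↦ ω(b)•X(b))` for a real bond function `ω`.
[cite: Balaban1985BackgroundPropagators, (3.11) p.392] -/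
theorem exists_smulBond (ω : PBond (F.P K) 0 → ℝ) :
    ∃ M : BondL2K ℂ 3 (periodsT3 F K) c₀ W₂ →ₗ[ℂ] BondL2K ℂ 3 (periodsT3 F K) c₀ W₂,
      ∀ X : PBond (F.P K) 0 → Matrix (Fin 2) (Fin 2) ℂ, M (toL2 F K c₀ X) = toL2 F K c₀ (fun b => ω b • X b) := by
  refine ⟨(toL2 F K c₀).toLinearMap ∘ₗ (LinearMap.pi fun b : PBond (F.P K) 0 => ((ω b : ℝ) : ℂ) • LinearMap.proj b) ∘ₗ (toL2 F K c₀).symm.toLinearMap,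
    fun X => ?_⟩
  have e : (LinearMap.pi fun b : PBond (F.P K) 0 => ((ω b : ℝ) : ℂ) • LinearMap.proj (R := ℂ) (φ := fun _ : PBond (F.P K) 0 => Matrix (Fin 2) (Fin 2) ℂ) b) X
      = fun b => ω b • X b := by
    funext b
    rw [LinearMap.pi_apply, LinearMap.smul_apply, LinearMap.proj_apply, Complex.coe_smul]
  rw [LinearMap.comp_apply, LinearMap.comp_apply, LinearEquiv.coe_toLinearMap, LinearEquiv.coe_toLinearMap, LinearEquiv.symm_apply_apply, e]

/-- `‖toL2 X‖² = Σ_μ ‖toL2S X_μ‖²` (the bond norm is the sum of the component norms; A1 ✓`sum_inner_toL2S_formComp` at `Y = X`). [cite: Balaban1985BackgroundPropagators, (3.11) p.392] -/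
theorem norm_sq_toL2_eq_sum_formComp (X : PBond (F.P K) 0 → Matrix (Fin 2) (Fin 2) ℂ) :
    ‖toL2 F K c₀ X‖ ^ 2 = ∑ μ : Fin (F.P K).d, ‖toL2S F K c₀ (formComp X μ)‖ ^ 2 := by
  have h := sum_inner_toL2S_formComp (c₀ := c₀) X X
  rw [← inner_self_eq_norm_sq (𝕜 := ℂ), ← h, map_sum]
  exact Finset.sum_congr rfl fun μ _ => inner_self_eq_norm_sq _

/-- ★ **THE KATO GRADIENT `D : A ↦ (D_{U₀}A_μ)_μ` INTO `PiLp 2 (Fin 3 → BondL2K)`, ∃-PACKAGED** with its three readings: the components, the norm `‖Dv‖² = Σ_μ ‖D_{U₀}(toL2S (toL2⁻¹v)_μ)‖²`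
(the Kato energy of A1∕O2, `η⁻²` inside `D_{U₀}`), and the pairing. [cite: Balaban1985BackgroundPropagators, (3.3) p.391, (3.23) p.394; Balaban1985Variational, (135) p.298] -/
theorem exists_katoGradient (U₀ : GaugeField (F.P K) 0 (Matrix.specialUnitaryGroup (Fin 2) ℂ)) :
    ∃ D : BondL2K ℂ 3 (periodsT3 F K) c₀ W₂ →ₗ[ℂ] PiLp 2 (fun _ : Fin (F.P K).d => BondL2K ℂ 3 (periodsT3 F K) c₀ W₂),
      (∀ (X : PBond (F.P K) 0 → Matrix (Fin 2) (Fin 2) ℂ) (μ : Fin (F.P K).d),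
          WithLp.ofLp (D (toL2 F K c₀ X)) μ = DL2 F n K c₀ U₀ (toL2S F K c₀ (formComp X μ))) ∧
      (∀ X : PBond (F.P K) 0 → Matrix (Fin 2) (Fin 2) ℂ,
          ‖D (toL2 F K c₀ X)‖ ^ 2 = ∑ μ : Fin (F.P K).d, ‖DL2 F n K c₀ U₀ (toL2S F K c₀ (formComp X μ))‖ ^ 2) ∧
      (∀ X Y : PBond (F.P K) 0 → Matrix (Fin 2) (Fin 2) ℂ,
          ⟪D (toL2 F K c₀ X), D (toL2 F K c₀ Y)⟫_ℂ = ∑ μ : Fin (F.P K).d, ⟪DL2 F n K c₀ U₀ (toL2S F K c₀ (formComp X μ)), DL2 F n K c₀ U₀ (toL2S F K c₀ (formComp Y μ))⟫_ℂ) := by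
  set Φ := WithLp.linearEquiv 2 ℂ (Fin (F.P K).d → BondL2K ℂ 3 (periodsT3 F K) c₀ W₂) with hΦ
  set D : BondL2K ℂ 3 (periodsT3 F K) c₀ W₂ →ₗ[ℂ] PiLp 2 (fun _ : Fin (F.P K).d => BondL2K ℂ 3 (periodsT3 F K) c₀ W₂) :=
    Φ.symm.toLinearMap ∘ₗ (LinearMap.pi fun μ : Fin (F.P K).d =>
      DL2 F n K c₀ U₀ ∘ₗ (toL2S F K c₀).toLinearMap ∘ₗ LinearMap.funLeft ℂ (Matrix (Fin 2) (Fin 2) ℂ) (fun x : Site (F.P K) 0 => (⟨x, μ⟩ : PBond (F.P K) 0))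
        ∘ₗ (toL2 F K c₀).symm.toLinearMap) with hD
  have hcomp : ∀ (X : PBond (F.P K) 0 → Matrix (Fin 2) (Fin 2) ℂ) (μ : Fin (F.P K).d),
      WithLp.ofLp (D (toL2 F K c₀ X)) μ = DL2 F n K c₀ U₀ (toL2S F K c₀ (formComp X μ)) := by
    intro X μ
    simp only [hD, LinearMap.comp_apply, LinearEquiv.coe_toLinearMap, hΦ, WithLp.coe_symm_linearEquiv, WithLp.ofLp_toLp, LinearMap.pi_apply,
      LinearEquiv.symm_apply_apply]
    rfl
  have hinner : ∀ X Y : PBond (F.P K) 0 → Matrix (Fin 2) (Fin 2) ℂ,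
      ⟪D (toL2 F K c₀ X), D (toL2 F K c₀ Y)⟫_ℂ = ∑ μ : Fin (F.P K).d, ⟪DL2 F n K c₀ U₀ (toL2S F K c₀ (formComp X μ)), DL2 F n K c₀ U₀ (toL2S F K c₀ (formComp Y μ))⟫_ℂ := by
    intro X Y
    rw [PiLp.inner_apply]
    exact Finset.sum_congr rfl fun μ _ => by rw [hcomp, hcomp]
  refine ⟨D, hcomp, fun X => ?_, hinner⟩
  rw [← inner_self_eq_norm_sq (𝕜 := ℂ), hinner, map_sum]
  exact Finset.sum_congr rfl fun μ _ => inner_self_eq_norm_sq _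

/-! ## §2 The assembly -/

variable {h : n ≤ K} {cB a : ℝ} [Fact (0 < cB)]
  {Δx : GaugeField (F.P K) 0 (Matrix.specialUnitaryGroup (Fin 2) ℂ) → (BondL2K ℂ 3 (periodsT3 F K) c₀ W₂ →ₗ[ℂ] BondL2K ℂ 3 (periodsT3 F K) c₀ W₂)}

/-- ★★★ **THE WEIGHTED-`L²` BOUND FOR THE MEMBER's ONE-FORM OPERATOR, ASSEMBLED.**  `U₀` ANY background, `Δx` any slot, `a` any coupling; `w : sites → ℝ` positive with
`|w(b₊)∕w(b₋) − 1| ≤ ρ` and `|w(b₋)∕w(b₊) − 1| ≤ ρ` on every bond; `u f` with `Δ_a u = f` (`Δ_a = laplaceA … Δx U₀`).  DISPLAYED FORM LETTERS: (γ) `hco : γ‖v‖² ≤ re⟪v, Δ_av⟫`;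
(C_V) `hVlow : −C_V‖toL2 X‖² ≤ re⟪toL2 X, Δ_a(toL2 X)⟫ − Σ_μ‖D_{U₀}X_μ‖²` (⟸ A1 ✓`katoEnergy_le` + the slot's form bound); (θ_V) `hVconj` — the conjugation defect of the remainder
`V = Δ_a − D†D` in form (A2, px21 g14).  THEN for `0 < ε ≤ 1`:
`((1−ε)γ − ε·C_V − 3η⁻²ρ²(1 + 1∕ε) − θ_V)·‖toL2(w∘src • toL2⁻¹u)‖ ≤ ‖toL2(w∘src • toL2⁻¹f)‖` — A1 ✓`agmon_bound_of_garding` with the Kato gradient of `exists_katoGradient`, the multipliers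
of `exists_smulBond`, and the gradient defects `K₁ = M′i∘D∘M − D`, `K₁′ = M′∘D∘Mi − D` whose bounds `δ₁ = √3·η⁻¹ρ` are px5 g11's ✓`DL2_smul_eq_smul_add_defect` + ✓`normSq_gradDefect_le` per component.
CONDITIONAL on (γ)(C_V)(θ_V). [cite: Balaban1985BackgroundPropagators, Thm 3.1 (3.46) p.398, Thm 3.12 p.422, (3.26) p.395; Balaban1985Variational, (134)–(136) p.298] -/
theorem agmon_oneForm_of_letters (U₀ : GaugeField (F.P K) 0 (Matrix.specialUnitaryGroup (Fin 2) ℂ))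
    (w : Site (F.P K) 0 → ℝ) (hw : ∀ x, 0 < w x) {ρ : ℝ}
    (hρ : ∀ b : PBond (F.P K) 0, |w b.tgt / w b.src - 1| ≤ ρ) (hρ' : ∀ b : PBond (F.P K) 0, |w b.src / w b.tgt - 1| ≤ ρ)
    {γ CV θV ε : ℝ} (hε : 0 < ε) (hε1 : ε ≤ 1)
    (hco : ∀ v : BondL2K ℂ 3 (periodsT3 F K) c₀ W₂, γ * ‖v‖ ^ 2 ≤ RCLike.re ⟪v, laplaceA F n K h c₀ cB a Δx U₀ v⟫_ℂ)
    (hVlow : ∀ X : PBond (F.P K) 0 → Matrix (Fin 2) (Fin 2) ℂ,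
      -(CV * ‖toL2 F K c₀ X‖ ^ 2) ≤ RCLike.re ⟪toL2 F K c₀ X, laplaceA F n K h c₀ cB a Δx U₀ (toL2 F K c₀ X)⟫_ℂ
        - ∑ μ : Fin (F.P K).d, ‖DL2 F n K c₀ U₀ (toL2S F K c₀ (formComp X μ))‖ ^ 2)
    (hVconj : ∀ X : PBond (F.P K) 0 → Matrix (Fin 2) (Fin 2) ℂ,
      RCLike.re ⟪toL2 F K c₀ X, laplaceA F n K h c₀ cB a Δx U₀ (toL2 F K c₀ X)⟫_ℂ
          - (∑ μ : Fin (F.P K).d, ‖DL2 F n K c₀ U₀ (toL2S F K c₀ (formComp X μ))‖ ^ 2) - θV * ‖toL2 F K c₀ X‖ ^ 2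
        ≤ RCLike.re ⟪toL2 F K c₀ (fun b => w b.src • X b), laplaceA F n K h c₀ cB a Δx U₀ (toL2 F K c₀ (fun b => (w b.src)⁻¹ • X b))⟫_ℂ
          - RCLike.re (∑ μ : Fin (F.P K).d, ⟪DL2 F n K c₀ U₀ (toL2S F K c₀ (formComp (fun b => w b.src • X b) μ)),
              DL2 F n K c₀ U₀ (toL2S F K c₀ (formComp (fun b => (w b.src)⁻¹ • X b) μ))⟫_ℂ))
    (u f : BondL2K ℂ 3 (periodsT3 F K) c₀ W₂) (hu : laplaceA F n K h c₀ cB a Δx U₀ u = f) :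
    ((1 - ε) * γ - ε * CV - 3 * ((eta F n K)⁻¹) ^ 2 * ρ ^ 2 * (1 + 1 / ε) - θV) * ‖toL2 F K c₀ (fun b => w b.src • (toL2 F K c₀).symm u b)‖
      ≤ ‖toL2 F K c₀ (fun b => w b.src • (toL2 F K c₀).symm f b)‖ := by
  have hw0 : ∀ x, w x ≠ 0 := fun x => (hw x).ne'
  have hwi0 : ∀ x, (w x)⁻¹ ≠ 0 := fun x => inv_ne_zero (hw0 x)
  have hρ'' : ∀ b : PBond (F.P K) 0, |(w b.tgt)⁻¹ / (w b.src)⁻¹ - 1| ≤ ρ := fun b => by rw [inv_div_inv]; exact hρ' b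
  -- every `L²` vector is a route field
  have surj : ∀ v : BondL2K ℂ 3 (periodsT3 F K) c₀ W₂, ∃ X, v = toL2 F K c₀ X := fun v => ⟨(toL2 F K c₀).symm v, ((toL2 F K c₀).apply_symm_apply v).symm⟩
  -- the Kato gradient and its adjoint
  obtain ⟨D, hDcomp, hDnorm, hDinner⟩ := exists_katoGradient (c₀ := c₀) (n := n) U₀
  set Dad := LinearMap.adjoint D with hDad_def
  have hDad : ∀ (v : BondL2K ℂ 3 (periodsT3 F K) c₀ W₂) (g : PiLp 2 (fun _ : Fin (F.P K).d => BondL2K ℂ 3 (periodsT3 F K) c₀ W₂)), ⟪D v, g⟫_ℂ = ⟪v, Dad g⟫_ℂ :=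
    fun v g => (LinearMap.adjoint_inner_right D v g).symm
  -- `T = Δ_a`, `V = Δ_a − D†D`
  set T := laplaceA F n K h c₀ cB a Δx U₀ with hT_def
  set V : BondL2K ℂ 3 (periodsT3 F K) c₀ W₂ →ₗ[ℂ] BondL2K ℂ 3 (periodsT3 F K) c₀ W₂ := T - Dad ∘ₗ D with hV_def
  have hT : ∀ v, T v = Dad (D v) + V v := fun v => by
    rw [hV_def, LinearMap.sub_apply, LinearMap.comp_apply, add_sub_cancel]
  have hVform : ∀ X : PBond (F.P K) 0 → Matrix (Fin 2) (Fin 2) ℂ, RCLike.re ⟪toL2 F K c₀ X, V (toL2 F K c₀ X)⟫_ℂ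
      = RCLike.re ⟪toL2 F K c₀ X, T (toL2 F K c₀ X)⟫_ℂ - ∑ μ : Fin (F.P K).d, ‖DL2 F n K c₀ U₀ (toL2S F K c₀ (formComp X μ))‖ ^ 2 := by
    intro X
    rw [hV_def, LinearMap.sub_apply, LinearMap.comp_apply, inner_sub_right, map_sub, ← hDad, inner_self_eq_norm_sq, hDnorm]
  -- the multipliers on `E`
  obtain ⟨M, hM⟩ := exists_smulBond (c₀ := c₀) (F := F) (K := K) (fun b : PBond (F.P K) 0 => w b.src)
  obtain ⟨Mi, hMi⟩ := exists_smulBond (c₀ := c₀) (F := F) (K := K) (fun b : PBond (F.P K) 0 => (w b.src)⁻¹)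
  have hMiM : ∀ v, Mi (M v) = v := fun v => by
    obtain ⟨X, rfl⟩ := surj v
    rw [hM, hMi]; congr 1; funext b; rw [smul_smul, inv_mul_cancel₀ (hw0 _), one_smul]
  have hMMi : ∀ v, M (Mi v) = v := fun v => by
    obtain ⟨X, rfl⟩ := surj v
    rw [hMi, hM]; congr 1; funext b; rw [smul_smul, mul_inv_cancel₀ (hw0 _), one_smul]
  have hMsa : ∀ x y : BondL2K ℂ 3 (periodsT3 F K) c₀ W₂, ⟪M x, y⟫_ℂ = ⟪x, M y⟫_ℂ := fun x y => by
    obtain ⟨X, rfl⟩ := surj x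
    obtain ⟨Y, rfl⟩ := surj y
    rw [hM, hM]
    exact inner_toL2_smul_left F _ X Y
  -- the multipliers on `G`, componentwise
  set Φ := WithLp.linearEquiv 2 ℂ (Fin (F.P K).d → BondL2K ℂ 3 (periodsT3 F K) c₀ W₂) with hΦ
  set M' : PiLp 2 (fun _ : Fin (F.P K).d => BondL2K ℂ 3 (periodsT3 F K) c₀ W₂) →ₗ[ℂ] PiLp 2 (fun _ : Fin (F.P K).d => BondL2K ℂ 3 (periodsT3 F K) c₀ W₂) :=
    Φ.symm.toLinearMap ∘ₗ (LinearMap.pi fun μ : Fin (F.P K).d => M ∘ₗ LinearMap.proj μ) ∘ₗ Φ.toLinearMap with hM'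
  set M'i : PiLp 2 (fun _ : Fin (F.P K).d => BondL2K ℂ 3 (periodsT3 F K) c₀ W₂) →ₗ[ℂ] PiLp 2 (fun _ : Fin (F.P K).d => BondL2K ℂ 3 (periodsT3 F K) c₀ W₂) :=
    Φ.symm.toLinearMap ∘ₗ (LinearMap.pi fun μ : Fin (F.P K).d => Mi ∘ₗ LinearMap.proj μ) ∘ₗ Φ.toLinearMap with hM'i
  have hM'_of : ∀ z μ, WithLp.ofLp (M' z) μ = M (WithLp.ofLp z μ) := fun z μ => by
    simp only [hM', LinearMap.comp_apply, LinearEquiv.coe_toLinearMap, hΦ, WithLp.coe_symm_linearEquiv, WithLp.coe_linearEquiv, WithLp.ofLp_toLp,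
      LinearMap.pi_apply, LinearMap.proj_apply]
  have hM'i_of : ∀ z μ, WithLp.ofLp (M'i z) μ = Mi (WithLp.ofLp z μ) := fun z μ => by
    simp only [hM'i, LinearMap.comp_apply, LinearEquiv.coe_toLinearMap, hΦ, WithLp.coe_symm_linearEquiv, WithLp.coe_linearEquiv, WithLp.ofLp_toLp,
      LinearMap.pi_apply, LinearMap.proj_apply]
  have ofLp_inj : ∀ x y : PiLp 2 (fun _ : Fin (F.P K).d => BondL2K ℂ 3 (periodsT3 F K) c₀ W₂), WithLp.ofLp x = WithLp.ofLp y → x = y :=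
    fun x y hxy => by rw [← WithLp.toLp_ofLp (p := 2) x, hxy, WithLp.toLp_ofLp]
  have hM'M'i : ∀ z, M' (M'i z) = z := fun z => ofLp_inj _ _ (funext fun μ => by rw [hM'_of, hM'i_of, hMMi])
  have hM'iM' : ∀ z, M'i (M' z) = z := fun z => ofLp_inj _ _ (funext fun μ => by rw [hM'i_of, hM'_of, hMiM])
  have hinnerP : ∀ x y : PiLp 2 (fun _ : Fin (F.P K).d => BondL2K ℂ 3 (periodsT3 F K) c₀ W₂),
      ⟪x, y⟫_ℂ = ∑ μ : Fin (F.P K).d, ⟪WithLp.ofLp x μ, WithLp.ofLp y μ⟫_ℂ := fun x y => PiLp.inner_apply x y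
  have hpair : ∀ x y, ⟪M' x, M'i y⟫_ℂ = ⟪x, y⟫_ℂ := fun x y => by
    rw [hinnerP, hinnerP x y]
    refine Finset.sum_congr rfl fun μ _ => ?_
    rw [hM'_of, hM'i_of]
    obtain ⟨X, hX⟩ := surj (WithLp.ofLp x μ)
    obtain ⟨Y, hY⟩ := surj (WithLp.ofLp y μ)
    rw [hX, hY, hM, hMi]
    exact inner_toL2_smul_smul_inv F (fun b : PBond (F.P K) 0 => w b.src) (fun b => hw0 b.src) X Y
  -- the gradient defects
  set K₁ : BondL2K ℂ 3 (periodsT3 F K) c₀ W₂ →ₗ[ℂ] PiLp 2 (fun _ : Fin (F.P K).d => BondL2K ℂ 3 (periodsT3 F K) c₀ W₂) := M'i ∘ₗ D ∘ₗ M - D with hK₁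
  set K₁' : BondL2K ℂ 3 (periodsT3 F K) c₀ W₂ →ₗ[ℂ] PiLp 2 (fun _ : Fin (F.P K).d => BondL2K ℂ 3 (periodsT3 F K) c₀ W₂) := M' ∘ₗ D ∘ₗ Mi - D with hK₁'
  have hK₁v : ∀ v, K₁ v = M'i (D (M v)) - D v := fun v => rfl
  have hK₁'v : ∀ v, K₁' v = M' (D (Mi v)) - D v := fun v => rfl
  have hK₁eq : ∀ v, D (M v) = M' (D v + K₁ v) := fun v => by
    rw [hK₁v, add_sub_cancel, hM'M'i]
  have hK₁'eq : ∀ v, D (Mi v) = M'i (D v + K₁' v) := fun v => by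
    rw [hK₁'v, add_sub_cancel, hM'iM']
  -- the component of a defect is px5 g11's relative gradient defect
  have hdef : ∀ (ω : Site (F.P K) 0 → ℝ) (hω : ∀ x, ω x ≠ 0) (Mω Mωi : BondL2K ℂ 3 (periodsT3 F K) c₀ W₂ →ₗ[ℂ] BondL2K ℂ 3 (periodsT3 F K) c₀ W₂)
      (hMω : ∀ X : PBond (F.P K) 0 → Matrix (Fin 2) (Fin 2) ℂ, Mω (toL2 F K c₀ X) = toL2 F K c₀ (fun b => ω b.src • X b))
      (hMωi : ∀ X : PBond (F.P K) 0 → Matrix (Fin 2) (Fin 2) ℂ, Mωi (toL2 F K c₀ X) = toL2 F K c₀ (fun b => (ω b.src)⁻¹ • X b))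
      (X : PBond (F.P K) 0 → Matrix (Fin 2) (Fin 2) ℂ) (μ : Fin (F.P K).d),
      Mωi (WithLp.ofLp (D (Mω (toL2 F K c₀ X))) μ) - WithLp.ofLp (D (toL2 F K c₀ X)) μ
        = toL2 F K c₀ (fun b => ((eta F n K)⁻¹ * (ω b.tgt / ω b.src - 1)) • R (bgUnits F K U₀ b) (formComp X μ b.tgt)) := by
    intro ω hω Mω Mωi hMω hMωi X μ
    rw [hMω, hDcomp, hDcomp]
    -- `D(toL2S(ω•X_μ))` read back, then multiplied by `ω⁻¹`
    have hread : DL2 F n K c₀ U₀ (toL2S F K c₀ (formComp (fun b => ω b.src • X b) μ))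
        = toL2 F K c₀ ((toL2 F K c₀).symm (DL2 F n K c₀ U₀ (toL2S F K c₀ (fun x => ω x • formComp X μ x)))) := by
      rw [LinearEquiv.apply_symm_apply]; rfl
    have hread' : DL2 F n K c₀ U₀ (toL2S F K c₀ (formComp X μ)) = toL2 F K c₀ ((toL2 F K c₀).symm (DL2 F n K c₀ U₀ (toL2S F K c₀ (formComp X μ)))) := by
      rw [LinearEquiv.apply_symm_apply]
    rw [hread, hMωi, hread', ← map_sub]
    congr 1
    funext b
    rw [Pi.sub_apply, DL2_smul_eq_smul_add_defect F U₀ ω (formComp X μ) b (hω _), smul_smul, inv_mul_cancel₀ (hω _), one_smul, add_sub_cancel_left]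
  -- the defect bounds `‖K₁v‖², ‖K₁′v‖² ≤ 3η⁻²ρ²‖v‖²`
  have hδ₁sq : 0 ≤ 3 * ((eta F n K)⁻¹) ^ 2 * ρ ^ 2 := by positivity
  set δ₁ := Real.sqrt (3 * ((eta F n K)⁻¹) ^ 2 * ρ ^ 2) with hδ₁
  have hδ₁0 : 0 ≤ δ₁ := Real.sqrt_nonneg _
  have hδ₁2 : δ₁ ^ 2 = 3 * ((eta F n K)⁻¹) ^ 2 * ρ ^ 2 := Real.sq_sqrt hδ₁sq
  have hbound : ∀ (ω : Site (F.P K) 0 → ℝ) (hω : ∀ x, ω x ≠ 0) (hωρ : ∀ b : PBond (F.P K) 0, |ω b.tgt / ω b.src - 1| ≤ ρ)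
      (Mω Mωi : BondL2K ℂ 3 (periodsT3 F K) c₀ W₂ →ₗ[ℂ] BondL2K ℂ 3 (periodsT3 F K) c₀ W₂)
      (hMω : ∀ X : PBond (F.P K) 0 → Matrix (Fin 2) (Fin 2) ℂ, Mω (toL2 F K c₀ X) = toL2 F K c₀ (fun b => ω b.src • X b))
      (hMωi : ∀ X : PBond (F.P K) 0 → Matrix (Fin 2) (Fin 2) ℂ, Mωi (toL2 F K c₀ X) = toL2 F K c₀ (fun b => (ω b.src)⁻¹ • X b))
      (N : PiLp 2 (fun _ : Fin (F.P K).d => BondL2K ℂ 3 (periodsT3 F K) c₀ W₂) →ₗ[ℂ] PiLp 2 (fun _ : Fin (F.P K).d => BondL2K ℂ 3 (periodsT3 F K) c₀ W₂))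
      (hN : ∀ z μ, WithLp.ofLp (N z) μ = Mωi (WithLp.ofLp z μ))
      (v : BondL2K ℂ 3 (periodsT3 F K) c₀ W₂), ‖(N ∘ₗ D ∘ₗ Mω - D) v‖ ≤ δ₁ * ‖v‖ := by
    intro ω hω hωρ Mω Mωi hMω hMωi N hN v
    obtain ⟨X, rfl⟩ := surj v
    have hsq : ‖(N ∘ₗ D ∘ₗ Mω - D) (toL2 F K c₀ X)‖ ^ 2 ≤ (δ₁ * ‖toL2 F K c₀ X‖) ^ 2 := by
      rw [PiLp.norm_sq_eq_of_L2, mul_pow, hδ₁2, norm_sq_toL2_eq_sum_formComp, Finset.mul_sum]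
      refine Finset.sum_le_sum fun μ _ => ?_
      have hcompμ : WithLp.ofLp ((N ∘ₗ D ∘ₗ Mω - D) (toL2 F K c₀ X)) μ
          = toL2 F K c₀ (fun b => ((eta F n K)⁻¹ * (ω b.tgt / ω b.src - 1)) • R (bgUnits F K U₀ b) (formComp X μ b.tgt)) := by
        have e : (N ∘ₗ D ∘ₗ Mω - D) (toL2 F K c₀ X) = N (D (Mω (toL2 F K c₀ X))) - D (toL2 F K c₀ X) := rfl
        rw [e, WithLp.ofLp_sub, Pi.sub_apply, hN]
        exact hdef ω hω Mω Mωi hMω hMωi X μ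
      rw [hcompμ]
      exact normSq_gradDefect_le F U₀ ω hωρ (formComp X μ)
    have h0 : 0 ≤ δ₁ * ‖toL2 F K c₀ X‖ := by positivity
    exact (pow_le_pow_iff_left₀ (norm_nonneg _) h0 two_ne_zero).mp hsq
  have bK₁ : ∀ v, ‖K₁ v‖ ≤ δ₁ * ‖v‖ := fun v =>
    hbound w hw0 hρ M Mi hM hMi M'i hM'i_of v
  have bK₁' : ∀ v, ‖K₁' v‖ ≤ δ₁ * ‖v‖ := fun v => by
    have hMi' : ∀ X : PBond (F.P K) 0 → Matrix (Fin 2) (Fin 2) ℂ, Mi (toL2 F K c₀ X) = toL2 F K c₀ (fun b => (fun x => (w x)⁻¹) b.src • X b) := hMi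
    have hM'' : ∀ X : PBond (F.P K) 0 → Matrix (Fin 2) (Fin 2) ℂ, M (toL2 F K c₀ X) = toL2 F K c₀ (fun b => ((fun x => (w x)⁻¹) b.src)⁻¹ • X b) := fun X => by
      rw [hM]; congr 1; funext b; rw [inv_inv]
    exact hbound (fun x => (w x)⁻¹) hwi0 hρ'' Mi M hMi' hM'' M' hM'_of v
  -- the three form letters in the engine's currency
  have hco' : ∀ v, γ * ‖v‖ ^ 2 ≤ RCLike.re ⟪v, T v⟫_ℂ := hco
  have hVlow' : ∀ v, -(CV * ‖v‖ ^ 2) ≤ RCLike.re ⟪v, V v⟫_ℂ := fun v => by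
    obtain ⟨X, rfl⟩ := surj v
    rw [hVform]
    exact hVlow X
  have hVconj' : ∀ v, RCLike.re ⟪v, V v⟫_ℂ - θV * ‖v‖ ^ 2 ≤ RCLike.re ⟪M v, V (Mi v)⟫_ℂ := fun v => by
    obtain ⟨X, rfl⟩ := surj v
    rw [hVform, hV_def, LinearMap.sub_apply, LinearMap.comp_apply, inner_sub_right, map_sub, ← hDad, hM, hMi, hDinner]
    exact hVconj X
  -- the engine
  have hmain := agmon_bound_of_garding D Dad hDad T V hT M Mi M' M'i hMiM hMsa hpair K₁ K₁' hK₁eq hK₁'eq hδ₁0 hε hε1 hco' hVlow' bK₁ bK₁' hVconj' u f hu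
  rw [hδ₁2] at hmain
  -- read the weights back on the route carriers
  obtain ⟨Xu, hXu⟩ := surj u
  obtain ⟨Xf, hXf⟩ := surj f
  have hMu : M u = toL2 F K c₀ (fun b => w b.src • (toL2 F K c₀).symm u b) := by rw [hXu, hM, LinearEquiv.symm_apply_apply]
  have hMf : M f = toL2 F K c₀ (fun b => w b.src • (toL2 F K c₀).symm f b) := by rw [hXf, hM, LinearEquiv.symm_apply_apply]
  rw [hMu, hMf] at hmain
  calc ((1 - ε) * γ - ε * CV - 3 * ((eta F n K)⁻¹) ^ 2 * ρ ^ 2 * (1 + 1 / ε) - θV) * ‖toL2 F K c₀ (fun b => w b.src • (toL2 F K c₀).symm u b)‖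
      = ((1 - ε) * γ - ε * CV - 3 * (eta F n K)⁻¹ ^ 2 * ρ ^ 2 * (1 + 1 / ε) - θV) * ‖toL2 F K c₀ (fun b => w b.src • (toL2 F K c₀).symm u b)‖ := by ring
    _ ≤ _ := hmain

end Summit.QuantumFields.YangMills.Theorems.Prop7OneFormAgmon

end
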